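import Mathlib.MeasureTheory.Function.ConditionalExpectation.Real
import Mathlib.MeasureTheory.Function.ConditionalExpectation.PullOut
import Mathlib.MeasureTheory.Function.LpSpace.Complete
import Mathlib.MeasureTheory.Integral.DominatedConvergence
import Mathlib.Topology.Order.MonotoneConvergence
import HarnessLib

/-!
# Backward (reversed) martingale convergence of conditional expectations along a subsequence

Topic `Probability/Process`; theorems only. For a finite measure `μ`, a *decreasing* sequence of
sub-σ-algebras `ℱ 0 ≥ ℱ 1 ≥ ⋯` with intersection `ℱ_∞ = ⨅ n, ℱ n`, and a bounded integrable `f`,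
the conditional expectations `μ[f | ℱ n]` form a backward martingale and converge to
`μ[f | ℱ_∞]` (Durrett 2019, Thm. 4.7.3: a.s. and in `L¹`; Lévy's downward theorem). This file
proves the part of that statement needed by the extremal decomposition of Gibbs measures
(`LatticeModels/GibbsTailTriviality`): **almost sure convergence along a subsequence**
(`exists_strictMono_ae_tendsto_condExp_antitone`), by the Hilbert-space argument rather than by
upcrossings:

1. for `m₁ ≤ m₂`, `∫ μ[f|m₂] μ[f|m₁] = ∫ μ[f|m₁]²` (tower and pull-out), hence
   `∫ (μ[f|m₂] - μ[f|m₁])² = ∫ μ[f|m₂]² - ∫ μ[f|m₁]²` (`integral_sq_condExp_sub_condExp`);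
2. `a n = ∫ μ[f|ℱ n]²` is non-increasing and bounded below, so along a subsequence `φ` with
   `a (φ j) < inf a + 4⁻ʲ` the functions `μ[f|ℱ (φ j)]` are Cauchy in `L²`, hence in `L¹` with
   summable bounds, hence converge a.e. (Mathlib `ae_tendsto_of_cauchy_eLpNorm`);
3. the a.e. limit has an `ℱ n`-measurable version for every `n`, hence (a `limsup` version) an
   `ℱ_∞`-measurable one, and its integrals over `ℱ_∞`-sets agree with those of `f` (dominated
   convergence), so it is `μ[f|ℱ_∞]` (Durrett 2019, proof of Thm. 4.7.2).

## References

* R. Durrett, *Probability: Theory and Examples*, 5th ed., CUP 2019, §4.7, Thms. 4.7.1–4.7.3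
  (p. 236 of the held copy) [Durrett2019].
-/

noncomputable section

open MeasureTheory Filter Topology
open scoped ENNReal

namespace Literature.Probability.Process

variable {Ω : Type*} {m0 : MeasurableSpace Ω} {μ : Measure Ω}

/-! ### Orthogonality of backward martingale increments -/

section Orthogonality

variable [IsFiniteMeasure μ] {m₁ m₂ : MeasurableSpace Ω} {f : Ω → ℝ} {C : ℝ}

/-- For `m₁ ≤ m₂ ≤ m0` and bounded integrable `f`:
`∫ μ[f|m₂] · μ[f|m₁] dμ = ∫ μ[f|m₁]² dμ` — the increments of the backward martingale
`μ[f|m₂], μ[f|m₁]` are orthogonal to `μ[f|m₁]` (tower property `μ[μ[f|m₂]|m₁] = μ[f|m₁]` and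
pull-out; Durrett 2019, §4.7, the martingale property `X_n = E(X_0|𝓕_n)`). [cite: Durrett2019, Thm. 4.7.1] -/
theorem integral_condExp_mul_condExp (hm₁₂ : m₁ ≤ m₂) (hm₂ : m₂ ≤ m0)
    (hfC : ∀ᵐ x ∂μ, |f x| ≤ C) :
    ∫ x, (μ[f|m₂]) x * (μ[f|m₁]) x ∂μ = ∫ x, (μ[f|m₁]) x ^ 2 ∂μ := by
  have hm₁ : m₁ ≤ m0 := hm₁₂.trans hm₂
  -- boundedness of the conditional expectations
  have hb₁ : ∀ᵐ x ∂μ, ‖(μ[f|m₁]) x‖ ≤ C := by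
    filter_upwards [ae_bdd_abs_condExp_of_ae_bdd_abs (m := m₁) hfC] with x hx
    rwa [Real.norm_eq_abs]
  have hsm₁ : StronglyMeasurable[m₁] (μ[f|m₁]) := stronglyMeasurable_condExp
  have hint₂ : Integrable (μ[f|m₂]) μ := integrable_condExp
  have hint₁ : Integrable (μ[f|m₁]) μ := integrable_condExp
  have hprod : Integrable (fun x => (μ[f|m₂]) x * (μ[f|m₁]) x) μ :=
    hint₂.mul_bdd (hsm₁.mono hm₁).aestronglyMeasurable hb₁
  -- `∫ u₂ u₁ = ∫ μ[u₂ u₁ | m₁] = ∫ μ[u₂|m₁] u₁ = ∫ u₁ u₁`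
  have htower : μ[μ[f|m₂]|m₁] =ᵐ[μ] μ[f|m₁] := condExp_condExp_of_le hm₁₂ hm₂
  have hpull : μ[(fun x => (μ[f|m₂]) x * (μ[f|m₁]) x)|m₁] =ᵐ[μ]
      fun x => (μ[μ[f|m₂]|m₁]) x * (μ[f|m₁]) x :=
    condExp_mul_of_stronglyMeasurable_right hsm₁ hprod hint₂
  calc ∫ x, (μ[f|m₂]) x * (μ[f|m₁]) x ∂μ
      = ∫ x, (μ[(fun x => (μ[f|m₂]) x * (μ[f|m₁]) x)|m₁]) x ∂μ := (integral_condExp hm₁).symm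
    _ = ∫ x, (μ[μ[f|m₂]|m₁]) x * (μ[f|m₁]) x ∂μ := integral_congr_ae hpull
    _ = ∫ x, (μ[f|m₁]) x * (μ[f|m₁]) x ∂μ := by
        refine integral_congr_ae ?_
        filter_upwards [htower] with x hx
        rw [hx]
    _ = ∫ x, (μ[f|m₁]) x ^ 2 ∂μ := by
        refine integral_congr_ae (ae_of_all _ fun x => ?_)
        simp [sq]

/-- **Pythagoras for backward martingales**: for `m₁ ≤ m₂ ≤ m0` and bounded integrable `f`,
`∫ (μ[f|m₂] - μ[f|m₁])² dμ = ∫ μ[f|m₂]² dμ - ∫ μ[f|m₁]² dμ` (Durrett 2019, §4.7, orthogonality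
of martingale increments as in Thm. 4.4.7/4.7.1). [cite: Durrett2019, Thm. 4.7.1] -/
theorem integral_sq_condExp_sub_condExp (hm₁₂ : m₁ ≤ m₂) (hm₂ : m₂ ≤ m0)
    (hfC : ∀ᵐ x ∂μ, |f x| ≤ C) :
    ∫ x, ((μ[f|m₂]) x - (μ[f|m₁]) x) ^ 2 ∂μ =
      ∫ x, (μ[f|m₂]) x ^ 2 ∂μ - ∫ x, (μ[f|m₁]) x ^ 2 ∂μ := by
  have hm₁ : m₁ ≤ m0 := hm₁₂.trans hm₂
  have hb₁ : ∀ᵐ x ∂μ, ‖(μ[f|m₁]) x‖ ≤ C := by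
    filter_upwards [ae_bdd_abs_condExp_of_ae_bdd_abs (m := m₁) hfC] with x hx
    rwa [Real.norm_eq_abs]
  have hb₂ : ∀ᵐ x ∂μ, ‖(μ[f|m₂]) x‖ ≤ C := by
    filter_upwards [ae_bdd_abs_condExp_of_ae_bdd_abs (m := m₂) hfC] with x hx
    rwa [Real.norm_eq_abs]
  have hint₂ : Integrable (μ[f|m₂]) μ := integrable_condExp
  have hint₁ : Integrable (μ[f|m₁]) μ := integrable_condExp
  have hae₁ : AEStronglyMeasurable[m0] (μ[f|m₁]) μ :=
    (stronglyMeasurable_condExp.mono hm₁).aestronglyMeasurable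
  have hae₂ : AEStronglyMeasurable[m0] (μ[f|m₂]) μ :=
    (stronglyMeasurable_condExp.mono hm₂).aestronglyMeasurable
  have h22 : Integrable (fun x => (μ[f|m₂]) x * (μ[f|m₂]) x) μ := hint₂.mul_bdd hae₂ hb₂
  have h21 : Integrable (fun x => (μ[f|m₂]) x * (μ[f|m₁]) x) μ := hint₂.mul_bdd hae₁ hb₁
  have h11 : Integrable (fun x => (μ[f|m₁]) x * (μ[f|m₁]) x) μ := hint₁.mul_bdd hae₁ hb₁
  have hcross := integral_condExp_mul_condExp hm₁₂ hm₂ hfC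
  have hsq₁ : ∫ x, (μ[f|m₁]) x ^ 2 ∂μ = ∫ x, (μ[f|m₁]) x * (μ[f|m₁]) x ∂μ :=
    integral_congr_ae (ae_of_all _ fun x => by simp [sq])
  have hsq₂ : ∫ x, (μ[f|m₂]) x ^ 2 ∂μ = ∫ x, (μ[f|m₂]) x * (μ[f|m₂]) x ∂μ :=
    integral_congr_ae (ae_of_all _ fun x => by simp [sq])
  have hexp : (fun x => ((μ[f|m₂]) x - (μ[f|m₁]) x) ^ 2) = fun x =>
      ((μ[f|m₂]) x * (μ[f|m₂]) x - 2 * ((μ[f|m₂]) x * (μ[f|m₁]) x)) +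
        (μ[f|m₁]) x * (μ[f|m₁]) x := by
    funext x; ring
  have hA : Integrable (fun x => (μ[f|m₂]) x * (μ[f|m₂]) x - 2 * ((μ[f|m₂]) x * (μ[f|m₁]) x)) μ :=
    h22.sub (h21.const_mul 2)
  have step1 : ∫ x, ((μ[f|m₂]) x * (μ[f|m₂]) x - 2 * ((μ[f|m₂]) x * (μ[f|m₁]) x)) +
      (μ[f|m₁]) x * (μ[f|m₁]) x ∂μ =
      ∫ x, ((μ[f|m₂]) x * (μ[f|m₂]) x - 2 * ((μ[f|m₂]) x * (μ[f|m₁]) x)) ∂μ +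
        ∫ x, (μ[f|m₁]) x * (μ[f|m₁]) x ∂μ :=
    integral_add hA h11
  have step2 : ∫ x, ((μ[f|m₂]) x * (μ[f|m₂]) x - 2 * ((μ[f|m₂]) x * (μ[f|m₁]) x)) ∂μ =
      ∫ x, (μ[f|m₂]) x * (μ[f|m₂]) x ∂μ - ∫ x, 2 * ((μ[f|m₂]) x * (μ[f|m₁]) x) ∂μ :=
    integral_sub h22 (h21.const_mul 2)
  rw [hexp, step1, step2, integral_const_mul, hcross, hsq₁, hsq₂]
  ring

/-- The `L²`-norms `∫ μ[f|m]² dμ` increase with the σ-algebra `m` (bounded integrable `f`)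
(Durrett 2019, §4.7; contraction of conditional expectation in `L²`). [cite: Durrett2019, Thm. 4.7.1] -/
theorem integral_sq_condExp_mono (hm₁₂ : m₁ ≤ m₂) (hm₂ : m₂ ≤ m0)
    (hfC : ∀ᵐ x ∂μ, |f x| ≤ C) :
    ∫ x, (μ[f|m₁]) x ^ 2 ∂μ ≤ ∫ x, (μ[f|m₂]) x ^ 2 ∂μ := by
  have h := integral_sq_condExp_sub_condExp hm₁₂ hm₂ hfC
  have hnn : 0 ≤ ∫ x, ((μ[f|m₂]) x - (μ[f|m₁]) x) ^ 2 ∂μ :=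
    integral_nonneg fun x => sq_nonneg _
  linarith

end Orthogonality

/-! ### A subsequence along which the conditional expectations are Cauchy in `L²` -/

section Subsequence

variable [IsFiniteMeasure μ] {ℱ : ℕ → MeasurableSpace Ω} {f : Ω → ℝ} {C : ℝ}

/-- For a decreasing sequence of σ-algebras `ℱ` and bounded `f`, the non-increasing bounded
sequence `a n = ∫ μ[f|ℱ n]²` converges, so there is a subsequence `φ` along which
`∫ (μ[f|ℱ (φ j)] - μ[f|ℱ (φ k)])² = a (φ j) - a (φ k) < 4⁻ʲ` for `j ≤ k` (Durrett 2019, §4.7: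
the backward martingale `E(Y|𝓕_n)` converges in `L²`, cf. Exercise 4.7.1; here only the Cauchy
property along a subsequence). [cite: Durrett2019, Thm. 4.7.1] -/
theorem exists_strictMono_integral_sq_condExp_sub_lt (hanti : Antitone ℱ) (hle : ∀ n, ℱ n ≤ m0)
    (hfC : ∀ᵐ x ∂μ, |f x| ≤ C) :
    ∃ φ : ℕ → ℕ, StrictMono φ ∧ ∀ j k, j ≤ k →
      ∫ x, ((μ[f|ℱ (φ j)]) x - (μ[f|ℱ (φ k)]) x) ^ 2 ∂μ < 4⁻¹ ^ j := by
  set a : ℕ → ℝ := fun n => ∫ x, (μ[f|ℱ n]) x ^ 2 ∂μ with ha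
  have hanti_a : Antitone a := fun n k hnk =>
    integral_sq_condExp_mono (hanti hnk) (hle n) hfC
  have hbdd : BddBelow (Set.range a) := ⟨0, by
    rintro _ ⟨n, rfl⟩
    exact integral_nonneg fun x => sq_nonneg _⟩
  set L := ⨅ n, a n with hL
  have hLle : ∀ n, L ≤ a n := fun n => ciInf_le hbdd n
  -- pick `N j` with `a (N j) < L + 4⁻ʲ`
  have hN : ∀ j : ℕ, ∃ N : ℕ, a N < L + 4⁻¹ ^ j := fun j =>
    exists_lt_of_ciInf_lt (lt_add_of_pos_right L (by positivity))
  choose N hN using hN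
  -- make it strictly increasing
  let φ : ℕ → ℕ := fun j => Nat.rec (N 0) (fun j φj => max (φj + 1) (N (j + 1))) j
  have hφ_succ : ∀ j, φ (j + 1) = max (φ j + 1) (N (j + 1)) := fun j => rfl
  have hφ_mono : StrictMono φ := strictMono_nat_of_lt_succ fun j => by
    rw [hφ_succ]
    exact Nat.lt_of_lt_of_le (Nat.lt_succ_self _) (le_max_left _ _)
  have hφN : ∀ j, N j ≤ φ j := by
    intro j
    cases j with
    | zero => exact le_rfl
    | succ j => rw [hφ_succ]; exact le_max_right _ _
  have haφ : ∀ j, a (φ j) < L + 4⁻¹ ^ j := fun j => (hanti_a (hφN j)).trans_lt (hN j)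
  refine ⟨φ, hφ_mono, fun j k hjk => ?_⟩
  have hℱ : ℱ (φ k) ≤ ℱ (φ j) := hanti (hφ_mono.monotone hjk)
  rw [integral_sq_condExp_sub_condExp hℱ (hle (φ j)) hfC]
  have h1 := haφ j
  have h2 := hLle (φ k)
  change a (φ j) - a (φ k) < 4⁻¹ ^ j
  linarith

end Subsequence

/-! ### Almost sure convergence along the subsequence and identification of the limit -/

section Limit

variable [IsFiniteMeasure μ] {ℱ : ℕ → MeasurableSpace Ω} {f : Ω → ℝ} {C : ℝ}

/-- Elementary inequality `|x| ≤ ε/2 + x²/(2ε)` for `ε > 0` (from `(|x| - ε)² ≥ 0`), used to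
turn the `L²` Cauchy property into summable `L¹` bounds. [folklore] -/
theorem abs_le_half_add_sq_div {ε : ℝ} (hε : 0 < ε) (x : ℝ) :
    |x| ≤ ε / 2 + x ^ 2 / (2 * ε) := by
  rw [show ε / 2 + x ^ 2 / (2 * ε) = (ε ^ 2 + x ^ 2) / (2 * ε) by field_simp,
    le_div_iff₀ (by positivity)]
  nlinarith [sq_nonneg (|x| - ε), sq_abs x, abs_nonneg x]

/-- **Backward martingale convergence along a subsequence (Lévy's downward theorem, a.s. part
along a subsequence).** Let `μ` be a finite measure, `ℱ` a decreasing sequence of sub-σ-algebras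
of `m0` and `f` a bounded integrable function. Then for some strictly increasing `φ : ℕ → ℕ`,
`μ[f | ℱ (φ j)] → μ[f | ⨅ n, ℱ n]` almost everywhere as `j → ∞`. This is a consequence of
Durrett 2019, Thm. 4.7.3 (`E(Y|𝓕_n) → E(Y|𝓕_{-∞})` a.s. and in `L¹` for `𝓕_n ↓ 𝓕_{-∞}`); the
proof given here is the `L²` argument described in the module docstring (orthogonal increments,
`L¹`-Cauchy subsequence, a.e. convergence, identification of the limit through its integrals
over `𝓕_{-∞}`-sets as in the proof of Durrett's Thm. 4.7.2). [cite: Durrett2019, Thm. 4.7.3] -/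
theorem exists_strictMono_ae_tendsto_condExp_antitone (hanti : Antitone ℱ) (hle : ∀ n, ℱ n ≤ m0)
    (hf : Integrable f μ) (hfC : ∀ᵐ x ∂μ, |f x| ≤ C) :
    ∃ φ : ℕ → ℕ, StrictMono φ ∧
      ∀ᵐ x ∂μ, Tendsto (fun j => (μ[f|ℱ (φ j)]) x) atTop (𝓝 ((μ[f|⨅ n, ℱ n]) x)) := by
  obtain ⟨φ, hφ, hcau⟩ := exists_strictMono_integral_sq_condExp_sub_lt hanti hle hfC
  refine ⟨φ, hφ, ?_⟩
  set v : ℕ → Ω → ℝ := fun j => μ[f|ℱ (φ j)] with hv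
  have hv_sm : ∀ j, StronglyMeasurable[ℱ (φ j)] (v j) := fun j => stronglyMeasurable_condExp
  have hv_meas : ∀ j, AEStronglyMeasurable[m0] (v j) μ := fun j =>
    ((hv_sm j).mono (hle _)).aestronglyMeasurable
  have hv_int : ∀ j, Integrable (v j) μ := fun j => integrable_condExp
  have hv_bdd : ∀ j, ∀ᵐ x ∂μ, |v j x| ≤ C := fun j => ae_bdd_abs_condExp_of_ae_bdd_abs hfC
  -- Step 1: summable `L¹` bounds along the subsequence
  set b : ℕ → ℝ := fun N => (μ.real Set.univ + 1) * 2⁻¹ ^ N with hb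
  have hb_pos : ∀ N, 0 < b N := fun N => by positivity
  have hb_sum : Summable b :=
    (summable_geometric_of_lt_one (by norm_num) (by norm_num)).mul_left _
  have hsq_int : ∀ n m, Integrable (fun x => (v n x - v m x) ^ 2) μ := by
    intro n m
    have hd : Integrable (fun x => v n x - v m x) μ := (hv_int n).sub (hv_int m)
    have hdb : ∀ᵐ x ∂μ, ‖v n x - v m x‖ ≤ C + C := by
      filter_upwards [hv_bdd n, hv_bdd m] with x h1 h2
      rw [Real.norm_eq_abs]
      exact (abs_sub _ _).trans (add_le_add h1 h2)
    have := hd.mul_bdd hd.aestronglyMeasurable hdb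
    refine this.congr (ae_of_all _ fun x => ?_)
    simp [sq]
  have hL1 : ∀ N n m, N ≤ n → N ≤ m → ∫ x, |v n x - v m x| ∂μ < b N := by
    intro N n m hn hm
    have hsq : ∫ x, (v n x - v m x) ^ 2 ∂μ < 4⁻¹ ^ N := by
      rcases le_total n m with hnm | hmn
      · exact (hcau n m hnm).trans_le (pow_le_pow_of_le_one (by norm_num) (by norm_num) hn)
      · have h := (hcau m n hmn).trans_le (pow_le_pow_of_le_one (by norm_num) (by norm_num) hm)
        refine lt_of_eq_of_lt (integral_congr_ae (ae_of_all _ fun x => ?_)) h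
        change (v n x - v m x) ^ 2 = (v m x - v n x) ^ 2
        ring
    have hε : (0 : ℝ) < 2⁻¹ ^ N := by positivity
    have hpt : ∀ x, |v n x - v m x| ≤
        2⁻¹ ^ N / 2 + (v n x - v m x) ^ 2 / (2 * 2⁻¹ ^ N) := fun x =>
      abs_le_half_add_sq_div hε _
    have hint_abs : Integrable (fun x => |v n x - v m x|) μ := ((hv_int n).sub (hv_int m)).abs
    have hint_rhs : Integrable (fun x => 2⁻¹ ^ N / 2 + (v n x - v m x) ^ 2 / (2 * 2⁻¹ ^ N)) μ :=
      (integrable_const _).add ((hsq_int n m).div_const _)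
    calc ∫ x, |v n x - v m x| ∂μ
        ≤ ∫ x, 2⁻¹ ^ N / 2 + (v n x - v m x) ^ 2 / (2 * 2⁻¹ ^ N) ∂μ :=
          integral_mono hint_abs hint_rhs hpt
      _ = 2⁻¹ ^ N / 2 * μ.real Set.univ + (∫ x, (v n x - v m x) ^ 2 ∂μ) / (2 * 2⁻¹ ^ N) := by
          rw [integral_add (integrable_const _) ((hsq_int n m).div_const _), integral_const,
            integral_div, smul_eq_mul, mul_comm]
      _ ≤ 2⁻¹ ^ N / 2 * μ.real Set.univ + 4⁻¹ ^ N / (2 * 2⁻¹ ^ N) := by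
          gcongr
      _ = 2⁻¹ ^ N / 2 * (μ.real Set.univ + 1) := by
          rw [show (4⁻¹ : ℝ) ^ N = 2⁻¹ ^ N * 2⁻¹ ^ N by rw [← mul_pow]; norm_num]
          field_simp
      _ < b N := by
          rw [hb]
          have hpos : 0 < μ.real Set.univ + 1 := by positivity
          nlinarith
  -- Step 2: a.e. convergence of the subsequence
  have hcauchy : ∀ N n m : ℕ, N ≤ n → N ≤ m →
      eLpNorm (v n - v m) 1 μ < ENNReal.ofReal (b N) := by
    intro N n m hn hm
    rw [eLpNorm_one_eq_lintegral_enorm,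
      ← ofReal_integral_norm_eq_lintegral_enorm ((hv_int n).sub (hv_int m)),
      ENNReal.ofReal_lt_ofReal_iff (hb_pos N)]
    simpa only [Pi.sub_apply, Real.norm_eq_abs] using hL1 N n m hn hm
  have hB : ∑' N, ENNReal.ofReal (b N) ≠ ∞ := by
    rw [← ENNReal.ofReal_tsum_of_nonneg (fun N => (hb_pos N).le) hb_sum]
    exact ENNReal.ofReal_ne_top
  have hae_conv : ∀ᵐ x ∂μ, ∃ l : ℝ, Tendsto (fun j => v j x) atTop (𝓝 l) :=
    MeasureTheory.Lp.ae_tendsto_of_cauchy_eLpNorm hv_meas le_rfl hB hcauchy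
  -- Step 3: the limit as a `limsup`, measurable for every `ℱ n`, hence for `⨅ ℱ`
  set G : Ω → ℝ := fun x => limsup (fun j => v j x) atTop with hG
  have hG_tend : ∀ᵐ x ∂μ, Tendsto (fun j => v j x) atTop (𝓝 (G x)) := by
    filter_upwards [hae_conv] with x hx
    obtain ⟨l, hl⟩ := hx
    have : G x = l := hl.limsup_eq
    rw [this]
    exact hl
  have hG_meas_n : ∀ n, Measurable[ℱ n] G := by
    intro n
    have hshift : G = fun x => limsup (fun j => v (j + n) x) atTop := by
      funext x
      exact (Filter.limsup_nat_add (fun j => v j x) n).symm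
    rw [hshift]
    refine Measurable.limsup fun j => ?_
    have h1 : Measurable[ℱ (φ (j + n))] (v (j + n)) := (hv_sm (j + n)).measurable
    exact h1.mono (hanti ((hφ.id_le n).trans (hφ.monotone (Nat.le_add_left n j)))) le_rfl
  have hG_meas : Measurable[⨅ n, ℱ n] G :=
    measurable_iff_comap_le.2 (le_iInf fun n => measurable_iff_comap_le.1 (hG_meas_n n))
  have hm : (⨅ n, ℱ n) ≤ m0 := (iInf_le ℱ 0).trans (hle 0)
  -- Step 4: the limit is bounded, integrable, and has the right integrals over `⨅ ℱ`-sets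
  have hG_bdd : ∀ᵐ x ∂μ, |G x| ≤ C := by
    have hall : ∀ᵐ x ∂μ, ∀ j, |v j x| ≤ C := ae_all_iff.2 hv_bdd
    filter_upwards [hG_tend, hall] with x hx hxC
    exact le_of_tendsto ((continuous_abs.tendsto _).comp hx) (Eventually.of_forall hxC)
  have hG_sm : StronglyMeasurable[m0] G := (hG_meas.mono hm le_rfl).stronglyMeasurable
  have hG_int : Integrable G μ :=
    (integrable_const C).mono' hG_sm.aestronglyMeasurable
      (hG_bdd.mono fun x hx => by rwa [Real.norm_eq_abs])
  have hG_eq : ∀ s, MeasurableSet[⨅ n, ℱ n] s → ∫ x in s, G x ∂μ = ∫ x in s, f x ∂μ := by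
    intro s hs
    have hs_j : ∀ j, MeasurableSet[ℱ (φ j)] s := fun j =>
      MeasurableSpace.measurableSet_iInf.1 hs (φ j)
    have hconst : ∀ j, ∫ x in s, v j x ∂μ = ∫ x in s, f x ∂μ := fun j =>
      setIntegral_condExp (hle (φ j)) hf (hs_j j)
    have hlim : Tendsto (fun j => ∫ x in s, v j x ∂μ) atTop (𝓝 (∫ x in s, G x ∂μ)) := by
      refine tendsto_integral_of_dominated_convergence (fun _ => C)
        (fun j => (hv_meas j).restrict) (integrable_const C) (fun j => ?_) ?_
      · exact ae_restrict_of_ae ((hv_bdd j).mono fun x hx => by rwa [Real.norm_eq_abs])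
      · exact ae_restrict_of_ae hG_tend
    have hlim' : Tendsto (fun j => ∫ x in s, v j x ∂μ) atTop (𝓝 (∫ x in s, f x ∂μ)) := by
      simp_rw [hconst]
      exact tendsto_const_nhds
    exact tendsto_nhds_unique hlim hlim'
  have hGcond : G =ᵐ[μ] μ[f|⨅ n, ℱ n] :=
    ae_eq_condExp_of_forall_setIntegral_eq hm hf (fun s _ _ => hG_int.integrableOn)
      (fun s hs _ => hG_eq s hs) hG_meas.stronglyMeasurable.aestronglyMeasurable
  -- Step 5: conclusion
  filter_upwards [hG_tend, hGcond] with x hx hxG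
  rwa [hxG] at hx

end Limit

end Literature.Probability.Process
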